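import Literature.AlgebraicGeometry.HodgeTheory.CyclicCoverPencilModelIsotopyProps
import HarnessLib

/-!
# The model isotopy of the nodal pencil: `J(0, ·) = id` and preservation of the saturated radius

Family `hodge`, layer `Literature/AlgebraicGeometry/HodgeTheory`; step A3b (third part), continuing `CyclicCoverPencilModelIsotopyProps`:
`J(0, x) = x` on the chart source (for affine coordinates in `Θ.source`), and, under the hypotheses of `chartModelIsotopy_nodal_spec`, the
saturated Morse radius `F = satRadius p Θ R''' R''` of `J(θ, x)` equals that of `x` when `Σ|Θ y(x)|² ≤ R'''` (both are the Morse radius there) —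
the hypothesis "the inside isotopy preserves `ρ`" of `Geometry/Manifold/ShellInterpolatedIsotopyPunctured`.

* `chartModelIsotopy_zero_of_mem`, `satRadius_chartModelIsotopy`.

Everything is proved; no definitions, no named facts.

## References

* [Milnor1968] J. Milnor, Singular Points of Complex Hypersurfaces (1968), §9 Lemma 9.4.
* [ArnoldGuseinzadeVarchenko2012] V. I. Arnold, S. M. Gusein-Zade, A. N. Varchenko, Singularities of Differentiable Maps II (2012), Part I §1.1.
-/

noncomputable section

open MvPolynomial Set Function Complex
open Literature.AlgebraicGeometry.Motives Literature.AlgebraicGeometry.Motives.UniversalHypersurface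
open Literature.AlgebraicGeometry.HodgeTheory.UniversalHypersurface Literature.Geometry.ComplexAnalytic

namespace Literature.AlgebraicGeometry.HodgeTheory

/-- **`J(0, x) = x`** for `x` in the chart source with affine coordinates in `Θ.source`. [cite: Milnor1968, §9 Lemma 9.4] -/
theorem chartModelIsotopy_zero_of_mem {n d : ℕ} {i : Fin (n + 2)} (a : Fin (n + 1) → ℕ)
    (Φ : OpenPartialHomeomorph (ComplexPoints (regularTotal ℂ n d)) (({m : DegIndex n d // m ≠ regPowIndex n d i} ⊕ Fin (n + 1)) → ℂ))
    (Θ : OpenPartialHomeomorph (Fin (n + 1) → ℂ) (Fin (n + 1) → ℂ))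
    {x : ComplexPoints (regularTotal ℂ n d)} (hx : x ∈ Φ.source) (hy : (fun j => Φ x (Sum.inr j)) ∈ Θ.source) :
    chartModelIsotopy a Φ Θ 0 x = x := by
  rw [chartModelIsotopy_of_mem a Φ Θ hx, PhamBrieskorn.modelIsotopy_zero a Θ hy]
  have h : (Sum.elim (fun m => Φ x (Sum.inl m)) (fun j => Φ x (Sum.inr j)) :
      ({m : DegIndex n d // m ≠ regPowIndex n d i} ⊕ Fin (n + 1)) → ℂ) = Φ x := by
    funext s; rcases s with m | j <;> rfl
  rw [h, Φ.left_inv hx]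

/-- **The model isotopy preserves the saturated Morse radius** (hypotheses of `chartModelIsotopy_nodal_spec`, `R''' < R''`,
`Σ|Θ y(x)|² ≤ R'''`). [cite: ArnoldGuseinzadeVarchenko2012, Part I §1.1] [cite: Milnor1968, §9 Lemma 9.4] -/
theorem satRadius_chartModelIsotopy {p : ℕ} (hp : 3 ≤ p)
    (Φ : OpenPartialHomeomorph (ComplexPoints (regularTotal ℂ 2 p)) (({m : DegIndex 2 p // m ≠ regPowIndex 2 p 2} ⊕ Fin (2 + 1)) → ℂ))
    (hΦ : ⇑Φ = regChartFun 2 p 2) (hΦs : Φ.source = regChartDom 2 p 2) (hΦt : Φ.target = regChartFun 2 p 2 '' regChartDom 2 p 2)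
    (Θ : OpenPartialHomeomorph (Fin (1 + 2) → ℂ) (Fin (1 + 2) → ℂ)) {r R''' R'' : ℝ}
    (hr : {z : Fin (1 + 2) → ℂ | ∑ i, ‖z i‖ ^ 2 ≤ r ^ 2} ⊆ Θ.target)
    (hΘφ : ∀ x ∈ Θ.source, ∑ i, (Θ x) i ^ PhamBrieskorn.cyclicNodeExponents p i = x 2 ^ p - (x 0 * x 1 + x 0 ^ p + x 1 ^ p))
    {ρW : ℝ}
    (hns : ∀ c : ℂ, c ≠ 0 → ‖c‖ < ρW → SmoothHypersurface.IsNonsingularForm ℂ (formOfCoeffs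
      (coeffsOf 2 p (cyclicCoverForm p (X 2 ^ (p - 2) * (X 0 * X 1) + X 0 ^ p + X 1 ^ p)) - Pi.single (regPowIndex 2 p 2) c)))
    (hR : R''' < R'')
    {x : ComplexPoints (regularTotal ℂ 2 p)} (hx : x ∈ Φ.source)
    (hb : ∀ m : {m : DegIndex 2 p // m ≠ regPowIndex 2 p 2},
      regCoeff ℂ 2 p x m.1 = coeffsOf 2 p (cyclicCoverForm p (X 2 ^ (p - 2) * (X 0 * X 1) + X 0 ^ p + X 1 ^ p)) m.1)
    (hy : (fun j => regChartFun 2 p 2 x (Sum.inr j)) ∈ Θ.source)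
    (hyr : ∑ i, ‖Θ (fun j => regChartFun 2 p 2 x (Sum.inr j)) i‖ ^ 2 < r ^ 2)
    (hyR : ∑ i, ‖Θ (fun j => regChartFun 2 p 2 x (Sum.inr j)) i‖ ^ 2 ≤ R''')
    (hc0 : pencilCoord p x ≠ 0) (hcρ : ‖pencilCoord p x‖ < ρW) (θ : ℝ) :
    satRadius p Θ R''' R'' (chartModelIsotopy (PhamBrieskorn.cyclicNodeExponents p) Φ Θ θ x) = satRadius p Θ R''' R'' x := by
  obtain ⟨hJs, -⟩ := chartModelIsotopy_nodal_spec hp Φ hΦ hΦs hΦt Θ hr hΘφ hns hx hb hy hyr hc0 hcρ θ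
  obtain ⟨hyJ, hSigJ⟩ := sum_norm_sq_chartModelIsotopy hp Φ hΦ hΦs hΦt Θ hr hΘφ hns hx hb hy hyr hc0 hcρ θ
  have hJd : chartModelIsotopy (PhamBrieskorn.cyclicNodeExponents p) Φ Θ θ x ∈ regChartDom 2 p 2 := hΦs ▸ hJs
  have hxd : x ∈ regChartDom 2 p 2 := hΦs ▸ hx
  rw [satRadius_eq_of_le p Θ R''' R'' hR hJd hyJ (hSigJ ▸ hyR), satRadius_eq_of_le p Θ R''' R'' hR hxd hy hyR, hSigJ]

end Literature.AlgebraicGeometry.HodgeTheory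

end
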